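import Literature.IUT.HodgeArakelov.CohomologyAmbientRestrict
import Literature.IUT.HodgeArakelov.EtaleThetaDataOfSettingPhiRangeAut
import Literature.IUT.HodgeArakelov.CohomologyAutFunctorialityLaws
import Literature.IUT.HodgeArakelov.CohomologyAutConjCompat

/-!
# [IUTchII] Prop 1.4 / Cor 1.12 (i) / Prop 3.4 (i) at the genuine data: the Π-INTRINSIC action of `Aut_top(Π^tp_X̲̲)` on
# `lim_J H¹(Π^tp_Ÿ̲̲ ∩ J, l·Δ_Θ)` (no companion on `(Π^tp_X)^Θ` needed)

abc-iut cell (WAVE-5 seat abc-iut-w5-d169; holder sub-row «P34i-GENUINE-(P1)» of DAG node IUTchII:Prop3.4(i),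
`plan/L6/SUBDAG-IUTchII-Prop-31-33-34.md`; L6-lead §F v1.19s).  S. Mochizuki, *Inter-universal Teichmüller theory II*,
kurims manuscript (Dec. 2020): Prop. 1.4 p. 27 ("functorial group-theoretic algorithms … `Π ↦ (l·Δ_Θ)(Π)` … a certain
subquotient of `Π`"), Cor. 1.12 (i) p. 57, Prop. 3.4 (i) p. 91 ("the left-hand square in each diagram arises from the
functoriality of the algorithms involved").  Claim key `Mochizuki2012` (DISPUTED, D-0012); [EtTh] Cor. 2.18 (i) p. 60
(refereed; FACT-LIST F-0620 `RigidData.Cor218_i`, consumed BY NAME).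

WHAT IS BUILT (data definitions + laws; no `Prop`-valued definition, no new named fact).  For the genuine
`φ : Π^tp_X̲̲ → (Π^tp_X)^Θ`, `l·Δ_Θ`, `Π^tp_Ÿ̲̲` of `EtaleThetaDataOfSetting.lean` and `α ∈ Aut_top(Π^tp_X̲̲)` stabilising
`Ker φ`, `φ⁻¹(l·Δ_Θ)`, `Π^tp_Ÿ̲̲` (the three [EtTh] Cor. 2.18 (i) clauses), under abc-iut-w5-d072's interface-topology
hypothesis `hq : IsQuotientMap D.toTheta`:
* `EtaleThetaDataOfSetting.autAct C hq α … : (coh C).lim ≃+ (coh C).lim` — THE action of `α` on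
  `lim_J H¹(Π^tp_Ÿ̲̲ ∩ J, l·Δ_Θ)`: abc-iut-L6-t1's `h1LimAutEquiv` for the pair `(α, rangeAut α)` at the RESTRICTED ambient
  `φ(Π^tp_X̲̲)` (`EtaleThetaDataOfSettingPhiRangeAut`), conjugated back by abc-iut-w5-d169's `ContH1Restrict.limEquiv`
  (`CohomologyAmbientRestrict`); laws `autAct_refl/_trans/_symm/_symm_symm/_congr` (a HOMOMORPHISM
  `Aut_top(Π^tp_X̲̲) → Aut(lim)`, from `CohomologyAutFunctorialityLaws` + `rangeAut_refl/_trans`) and the equivariance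
  `autAct_conj : ρ_α ∘ conj_h = conj_{α h} ∘ ρ_α` (`CohomologyAutConjCompat`);
* `pairRhoLim_eq_autAct` — whenever an X-level companion `β` of `α` on `(Π^tp_X)^Θ` exists, abc-iut-w5-d072's pair
  action `pairRhoLim C α β …` IS `autAct α` (so abc-iut-w4-d030's genuine inversion action is `autAct (ι|Π^tp_X̲̲)`);
* `autActOfCor218i` — the action of EVERY `α ∈ Aut_top(Π^tp_X̲̲)`, the three stabilisations supplied by F-0620 at
  abc-iut-L2-t8's `C.rigidData` (idiom of abc-iut-w4-d013), with the same laws.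
This replaces the DATA binder (P1) `EtaleLevels.AutCompanion` of abc-iut-w5-d169's p423712 by {F-0620, `hq`}.
Nothing here takes a side on [IUTchIII] Cor. 3.12; typed ≠ proved.
-/

noncomputable section

open Topology

namespace Literature.IUT.HodgeArakelov

namespace EtaleThetaDataOfSetting

open Literature.AnabelianGeometry.EtaleTheta CohomologySystemOfContH1

variable {p : ℕ} [Fact p.Prime] {D : Literature.AnabelianGeometry.EtaleTheta.ThetaSetting p}
  {E : D.EtaleThetaData} {l : ℕ} (C : E.DoubleUnderline l)

/-! ### 1. The genuine limit read at the restricted ambient `φ(Π^tp_X̲̲)` -/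

/-- **`lim_J H¹(Π^tp_Ÿ̲̲ ∩ J, l·Δ_Θ)` with coefficients read in `φ(Π^tp_X̲̲)`** instead of `(Π^tp_X)^Θ`: abc-iut-w5-d169's
`ContH1Restrict.limEquiv` at the genuine data. [cite: Mochizuki2012, Prop 1.4 p.27] -/
abbrev limRestrict : h1Lim (phi C) (D.lDeltaTheta l) (PiYdd C) ⊥ ≃+
    h1Lim (phiR C) ((D.lDeltaTheta l).subgroupOf (phiRange C)) (PiYdd C) ⊥ :=
  ContH1Restrict.limEquiv (phi C) (D.lDeltaTheta l) (PiYdd C) (phiRange C) (phi_mem_phiRange C)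
    (lDeltaTheta_le_phiRange C) ⊥

/-! ### 2. The Π-intrinsic action of `α ∈ Aut_top(Π^tp_X̲̲)` -/

section Act

variable (hq : IsQuotientMap D.toTheta) (α : (Pi C) ≃ₜ* (Pi C))
  (hker : ∀ x, x ∈ (phi C).ker ↔ α x ∈ (phi C).ker)
  (hA : ∀ x, x ∈ (D.lDeltaTheta l).comap (phi C) ↔ α x ∈ (D.lDeltaTheta l).comap (phi C))
  (hH : ∀ x, x ∈ PiYdd C ↔ α x ∈ PiYdd C)

/-- **The action `ρ_α` of `α ∈ Aut_top(Π^tp_X̲̲)` on `lim_J H¹(Π^tp_Ÿ̲̲ ∩ J, l·Δ_Θ)`** (for `α` stabilising `Ker φ`,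
`φ⁻¹(l·Δ_Θ)`, `Π^tp_Ÿ̲̲`; under `hq`): transport of structure along `(α, rangeAut α)` at the ambient `φ(Π^tp_X̲̲)`, read
back in the genuine limit. DEFINED. [cite: Mochizuki2012, Cor 1.12 (i) p.57] -/
def autAct : h1Lim (phi C) (D.lDeltaTheta l) (PiYdd C) ⊥ ≃+ h1Lim (phi C) (D.lDeltaTheta l) (PiYdd C) ⊥ :=
  ((limRestrict C).trans
    (h1LimAutEquiv (phiR C) ((D.lDeltaTheta l).subgroupOf (phiRange C)) (PiYdd C) α (rangeAut C α hker hq)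
      (rangeAut_phiR C α hker hq) (mem_lDeltaTheta_iff_rangeAut C α hker hq hA) hH)).trans
  (limRestrict C).symm

/-- `autAct` unfolded: `limRestrict (ρ_α x) = h1LimAut (α, rangeAut α) (limRestrict x)`. [cite: Mochizuki2012, Cor 1.12 (i) p.57] -/
theorem limRestrict_autAct (x : h1Lim (phi C) (D.lDeltaTheta l) (PiYdd C) ⊥) :
    limRestrict C (autAct C hq α hker hA hH x) =
      h1LimAut (phiR C) ((D.lDeltaTheta l).subgroupOf (phiRange C)) (PiYdd C) α (rangeAut C α hker hq)
        (rangeAut_phiR C α hker hq) (fun a ha => (mem_lDeltaTheta_iff_rangeAut C α hker hq hA a).mp ha) hH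
        (limRestrict C x) := by
  unfold autAct
  rw [AddEquiv.trans_apply, AddEquiv.trans_apply, AddEquiv.apply_symm_apply, h1LimAutEquiv_apply]

/-- The action depends on `α` only (congruence for rewriting the automorphism and the stabilisation proofs).
[cite: Mochizuki2012, Cor 1.12 (i) p.57] -/
theorem autAct_congr {α α' : (Pi C) ≃ₜ* (Pi C)} (h : α = α')
    (hker : ∀ x, x ∈ (phi C).ker ↔ α x ∈ (phi C).ker)
    (hA : ∀ x, x ∈ (D.lDeltaTheta l).comap (phi C) ↔ α x ∈ (D.lDeltaTheta l).comap (phi C))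
    (hH : ∀ x, x ∈ PiYdd C ↔ α x ∈ PiYdd C)
    (hker' : ∀ x, x ∈ (phi C).ker ↔ α' x ∈ (phi C).ker)
    (hA' : ∀ x, x ∈ (D.lDeltaTheta l).comap (phi C) ↔ α' x ∈ (D.lDeltaTheta l).comap (phi C))
    (hH' : ∀ x, x ∈ PiYdd C ↔ α' x ∈ PiYdd C) (x : h1Lim (phi C) (D.lDeltaTheta l) (PiYdd C) ⊥) :
    autAct C hq α hker hA hH x = autAct C hq α' hker' hA' hH' x := by
  subst h; rfl

/-- **COMPARISON**: whenever an X-level companion `β ∈ Aut_top((Π^tp_X)^Θ)` of `α` exists (`β ∘ φ = φ ∘ α`,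
`β(l·Δ_Θ) = l·Δ_Θ`), abc-iut-w5-d072's pair action `pairRhoLim C α β` IS `autAct α` (both send a cocycle `f` to
`β ∘ f ∘ α⁻¹ = rangeAut α ∘ f ∘ α⁻¹`). [cite: Mochizuki2012, Cor 1.12 (i) p.57] -/
theorem pairRhoLim_eq_autAct (β : D.GtpTheta ≃ₜ* D.GtpTheta) (hφ : ∀ g, β (phi C g) = phi C (α g))
    (hAβ : ∀ a : D.GtpTheta, a ∈ D.lDeltaTheta l ↔ β a ∈ D.lDeltaTheta l)
    (x : h1Lim (phi C) (D.lDeltaTheta l) (PiYdd C) ⊥) :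
    pairRhoLim C α β hφ hAβ hH x = autAct C hq α hker hA hH x := by
  apply (limRestrict C).injective
  rw [limRestrict_autAct]
  change limRestrict C (h1LimAut (phi C) (D.lDeltaTheta l) (PiYdd C) α β hφ (fun a ha => (hAβ a).mp ha) hH x) = _
  exact ContH1Restrict.limEquiv_h1LimAut (phi C) (D.lDeltaTheta l) (PiYdd C) (phiRange C) (phi_mem_phiRange C)
    (lDeltaTheta_le_phiRange C) α β (rangeAut C α hker hq) (coe_rangeAut_eq_of_companion C α hker hq β hφ) hφ
    (rangeAut_phiR C α hker hq) (fun a ha => (hAβ a).mp ha)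
    (fun a ha => (mem_lDeltaTheta_iff_rangeAut C α hker hq hA a).mp ha) hH x

/-- The stabilisation of `Ker φ` FOLLOWS from the existence of an X-level companion. [cite: Mochizuki2012, Cor 1.12 (i) p.57] -/
theorem ker_stable_of_companion (β : D.GtpTheta ≃ₜ* D.GtpTheta) (hφ : ∀ g, β (phi C g) = phi C (α g)) (x : Pi C) :
    x ∈ (phi C).ker ↔ α x ∈ (phi C).ker := by
  rw [MonoidHom.mem_ker, MonoidHom.mem_ker, ← hφ, map_eq_one_iff _ β.injective]

/-- … and so does the stabilisation of `φ⁻¹(l·Δ_Θ)` (if `β(l·Δ_Θ) = l·Δ_Θ`). [cite: Mochizuki2012, Cor 1.12 (i) p.57] -/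
theorem comap_stable_of_companion (β : D.GtpTheta ≃ₜ* D.GtpTheta) (hφ : ∀ g, β (phi C g) = phi C (α g))
    (hAβ : ∀ a : D.GtpTheta, a ∈ D.lDeltaTheta l ↔ β a ∈ D.lDeltaTheta l) (x : Pi C) :
    x ∈ (D.lDeltaTheta l).comap (phi C) ↔ α x ∈ (D.lDeltaTheta l).comap (phi C) := by
  rw [Subgroup.mem_comap, Subgroup.mem_comap, ← hφ]
  exact hAβ _

end Act

/-! ### 3. The action is a HOMOMORPHISM in `α` and intertwines conjugation -/

section Laws

variable (hq : IsQuotientMap D.toTheta)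

/-- **Identity law**: the identity of `Π^tp_X̲̲` acts as the identity. [cite: Mochizuki2012, Cor 1.12 (i) p.57] -/
theorem autAct_refl (hker : ∀ x, x ∈ (phi C).ker ↔ (ContinuousMulEquiv.refl (Pi C)) x ∈ (phi C).ker)
    (hA : ∀ x, x ∈ (D.lDeltaTheta l).comap (phi C) ↔
      (ContinuousMulEquiv.refl (Pi C)) x ∈ (D.lDeltaTheta l).comap (phi C))
    (hH : ∀ x, x ∈ PiYdd C ↔ (ContinuousMulEquiv.refl (Pi C)) x ∈ PiYdd C)
    (x : h1Lim (phi C) (D.lDeltaTheta l) (PiYdd C) ⊥) :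
    autAct C hq (ContinuousMulEquiv.refl (Pi C)) hker hA hH x = x := by
  unfold autAct
  rw [AddEquiv.trans_apply, AddEquiv.trans_apply,
    h1LimAutEquiv_congr (phiR C) ((D.lDeltaTheta l).subgroupOf (phiRange C)) (PiYdd C) rfl
      (rangeAut_refl C hq hker) _ _ _ (ContH1Aut.compat_refl (phiR C)) (fun _ => Iff.rfl) (stab_refl (PiYdd C)),
    h1LimAutEquiv_refl_apply, AddEquiv.symm_apply_apply]

/-- **Composition law**: `α₁ ≫ α₂` acts as the composite of the actions. [cite: Mochizuki2012, Cor 1.12 (i) p.57] -/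
theorem autAct_trans (α₁ α₂ : (Pi C) ≃ₜ* (Pi C))
    (hker₁ : ∀ x, x ∈ (phi C).ker ↔ α₁ x ∈ (phi C).ker)
    (hA₁ : ∀ x, x ∈ (D.lDeltaTheta l).comap (phi C) ↔ α₁ x ∈ (D.lDeltaTheta l).comap (phi C))
    (hH₁ : ∀ x, x ∈ PiYdd C ↔ α₁ x ∈ PiYdd C)
    (hker₂ : ∀ x, x ∈ (phi C).ker ↔ α₂ x ∈ (phi C).ker)
    (hA₂ : ∀ x, x ∈ (D.lDeltaTheta l).comap (phi C) ↔ α₂ x ∈ (D.lDeltaTheta l).comap (phi C))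
    (hH₂ : ∀ x, x ∈ PiYdd C ↔ α₂ x ∈ PiYdd C)
    (hker₁₂ : ∀ x, x ∈ (phi C).ker ↔ (α₁.trans α₂) x ∈ (phi C).ker)
    (hA₁₂ : ∀ x, x ∈ (D.lDeltaTheta l).comap (phi C) ↔ (α₁.trans α₂) x ∈ (D.lDeltaTheta l).comap (phi C))
    (hH₁₂ : ∀ x, x ∈ PiYdd C ↔ (α₁.trans α₂) x ∈ PiYdd C)
    (x : h1Lim (phi C) (D.lDeltaTheta l) (PiYdd C) ⊥) :
    autAct C hq (α₁.trans α₂) hker₁₂ hA₁₂ hH₁₂ x = autAct C hq α₂ hker₂ hA₂ hH₂ (autAct C hq α₁ hker₁ hA₁ hH₁ x) := by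
  unfold autAct
  rw [AddEquiv.trans_apply, AddEquiv.trans_apply, AddEquiv.trans_apply, AddEquiv.trans_apply,
    AddEquiv.trans_apply, AddEquiv.trans_apply, AddEquiv.apply_symm_apply,
    h1LimAutEquiv_trans_apply (phiR C) ((D.lDeltaTheta l).subgroupOf (phiRange C)) (PiYdd C)
      (rangeAut_phiR C α₁ hker₁ hq) (rangeAut_phiR C α₂ hker₂ hq)]
  congr 1
  exact h1LimAutEquiv_congr (phiR C) ((D.lDeltaTheta l).subgroupOf (phiRange C)) (PiYdd C) rfl
    (rangeAut_trans C hq α₁ α₂ hker₁ hker₂ hker₁₂) _ _ _ _ _ _ _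

/-- The inverse automorphism acts as the inverse. [cite: Mochizuki2012, Cor 1.12 (i) p.57] -/
theorem autAct_symm (α : (Pi C) ≃ₜ* (Pi C))
    (hker : ∀ x, x ∈ (phi C).ker ↔ α x ∈ (phi C).ker)
    (hA : ∀ x, x ∈ (D.lDeltaTheta l).comap (phi C) ↔ α x ∈ (D.lDeltaTheta l).comap (phi C))
    (hH : ∀ x, x ∈ PiYdd C ↔ α x ∈ PiYdd C)
    (hker' : ∀ x, x ∈ (phi C).ker ↔ α.symm x ∈ (phi C).ker)
    (hA' : ∀ x, x ∈ (D.lDeltaTheta l).comap (phi C) ↔ α.symm x ∈ (D.lDeltaTheta l).comap (phi C))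
    (hH' : ∀ x, x ∈ PiYdd C ↔ α.symm x ∈ PiYdd C)
    (x : h1Lim (phi C) (D.lDeltaTheta l) (PiYdd C) ⊥) :
    autAct C hq α.symm hker' hA' hH' x = (autAct C hq α hker hA hH).symm x := by
  apply (autAct C hq α hker hA hH).injective
  rw [AddEquiv.apply_symm_apply,
    ← autAct_trans C hq α.symm α hker' hA' hH' hker hA hH
      (ker_stable_trans C hker' hker) (fun y => by rw [ContinuousMulEquiv.trans_apply, ← hA, ← hA'])
      (fun y => by rw [ContinuousMulEquiv.trans_apply, ← hH, ← hH']),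
    autAct_congr C hq (show α.symm.trans α = ContinuousMulEquiv.refl _ from
      ContinuousMulEquiv.ext fun y => α.apply_symm_apply y) _ _ _ (ker_stable_refl C) (fun _ => Iff.rfl)
      (fun _ => Iff.rfl),
    autAct_refl]

/-- **Equivariance**: `ρ_α ∘ conj_h = conj_{α h} ∘ ρ_α` on the limit (`Π^tp_Ÿ̲̲` normal). [cite: Mochizuki2012, Prop 3.4 (i) p.91] -/
theorem autAct_conj [(PiYdd C).Normal] (α : (Pi C) ≃ₜ* (Pi C))
    (hker : ∀ x, x ∈ (phi C).ker ↔ α x ∈ (phi C).ker)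
    (hA : ∀ x, x ∈ (D.lDeltaTheta l).comap (phi C) ↔ α x ∈ (D.lDeltaTheta l).comap (phi C))
    (hH : ∀ x, x ∈ PiYdd C ↔ α x ∈ PiYdd C) (h : Pi C) (x : h1Lim (phi C) (D.lDeltaTheta l) (PiYdd C) ⊥) :
    autAct C hq α hker hA hH (h1LimConj (phi C) (D.lDeltaTheta l) (PiYdd C) h x) =
      h1LimConj (phi C) (D.lDeltaTheta l) (PiYdd C) (α h) (autAct C hq α hker hA hH x) := by
  apply (limRestrict C).injective
  rw [limRestrict_autAct, ContH1Restrict.limEquiv_h1LimConj, ContH1Restrict.limEquiv_h1LimConj, h1LimAut_h1LimConj,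
    limRestrict_autAct]

end Laws

/-! ### 4. The action of EVERY `α ∈ Aut_top(Π^tp_X̲̲)` from [EtTh] Cor 2.18 (i) (F-0620) -/

section FromCor218i

variable (hq : IsQuotientMap D.toTheta) {N : ℕ+} (μ : D.CyclotomeMod l N)

/-- **`ρ_α` for EVERY topological automorphism `α` of `Π^tp_X̲̲`**, the three stabilisations being the clauses of the
named FACT [EtTh] Cor. 2.18 (i) at `C.rigidData` (`Ker φ` = `thetaKer`, `φ⁻¹(l·Δ_Θ)` = `lDeltaTheta`, `Π^tp_Ÿ̲̲` = `PiYdd`).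
DEFINED. [cite: MochizukiEtTh2009, Cor 2.18 (i) p.60] -/
def autActOfCor218i (hC : D.Compat) (hS : D.Sec2Hyps)
    (h15 : D.Prop15iii E hC) (L : C.CuspLabels) (R : RigidData.{0} N l) (hR : R = C.rigidData μ hC hS h15 L)
    (h218i : R.Cor218_i) (α : (Pi C) ≃ₜ* (Pi C)) :
    h1Lim (phi C) (D.lDeltaTheta l) (PiYdd C) ⊥ ≃+ h1Lim (phi C) (D.lDeltaTheta l) (PiYdd C) ⊥ :=
  autAct C hq α (mem_ker_phi_iff_of_cor218_i C μ hC hS h15 L R hR h218i α)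
    (mem_comap_lDeltaTheta_iff_of_cor218_i C μ hC hS h15 L R hR h218i α)
    (mem_PiYdd_iff_of_cor218_i C μ hC hS h15 L R hR h218i α)

/-- `autActOfCor218i` depends on `α` only. [cite: MochizukiEtTh2009, Cor 2.18 (i) p.60] -/
theorem autActOfCor218i_congr (hC : D.Compat) (hS : D.Sec2Hyps)
    (h15 : D.Prop15iii E hC) (L : C.CuspLabels) (R : RigidData.{0} N l) (hR : R = C.rigidData μ hC hS h15 L)
    (h218i : R.Cor218_i) {α α' : (Pi C) ≃ₜ* (Pi C)} (h : α = α')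
    (x : h1Lim (phi C) (D.lDeltaTheta l) (PiYdd C) ⊥) :
    autActOfCor218i C hq μ hC hS h15 L R hR h218i α x = autActOfCor218i C hq μ hC hS h15 L R hR h218i α' x := by
  subst h; rfl

/-- Identity law. [cite: Mochizuki2012, Cor 1.12 (i) p.57] -/
theorem autActOfCor218i_refl (hC : D.Compat) (hS : D.Sec2Hyps)
    (h15 : D.Prop15iii E hC) (L : C.CuspLabels) (R : RigidData.{0} N l) (hR : R = C.rigidData μ hC hS h15 L)
    (h218i : R.Cor218_i) (x : h1Lim (phi C) (D.lDeltaTheta l) (PiYdd C) ⊥) :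
    autActOfCor218i C hq μ hC hS h15 L R hR h218i (ContinuousMulEquiv.refl (Pi C)) x = x :=
  autAct_refl C hq _ _ _ x

/-- Composition law. [cite: Mochizuki2012, Cor 1.12 (i) p.57] -/
theorem autActOfCor218i_trans (hC : D.Compat) (hS : D.Sec2Hyps)
    (h15 : D.Prop15iii E hC) (L : C.CuspLabels) (R : RigidData.{0} N l) (hR : R = C.rigidData μ hC hS h15 L)
    (h218i : R.Cor218_i) (α₁ α₂ : (Pi C) ≃ₜ* (Pi C)) (x : h1Lim (phi C) (D.lDeltaTheta l) (PiYdd C) ⊥) :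
    autActOfCor218i C hq μ hC hS h15 L R hR h218i (α₁.trans α₂) x =
      autActOfCor218i C hq μ hC hS h15 L R hR h218i α₂ (autActOfCor218i C hq μ hC hS h15 L R hR h218i α₁ x) :=
  autAct_trans C hq α₁ α₂ _ _ _ _ _ _ _ _ _ x

/-- Inverse law. [cite: Mochizuki2012, Cor 1.12 (i) p.57] -/
theorem autActOfCor218i_symm (hC : D.Compat) (hS : D.Sec2Hyps)
    (h15 : D.Prop15iii E hC) (L : C.CuspLabels) (R : RigidData.{0} N l) (hR : R = C.rigidData μ hC hS h15 L)
    (h218i : R.Cor218_i) (α : (Pi C) ≃ₜ* (Pi C)) (x : h1Lim (phi C) (D.lDeltaTheta l) (PiYdd C) ⊥) :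
    autActOfCor218i C hq μ hC hS h15 L R hR h218i α.symm x =
      (autActOfCor218i C hq μ hC hS h15 L R hR h218i α).symm x :=
  autAct_symm C hq α _ _ _ _ _ _ x

/-- … and the inverse of the action of `α⁻¹` is the action of `α`. [cite: Mochizuki2012, Cor 1.12 (i) p.57] -/
theorem autActOfCor218i_symm_symm (hC : D.Compat) (hS : D.Sec2Hyps)
    (h15 : D.Prop15iii E hC) (L : C.CuspLabels) (R : RigidData.{0} N l) (hR : R = C.rigidData μ hC hS h15 L)
    (h218i : R.Cor218_i) (α : (Pi C) ≃ₜ* (Pi C)) (x : h1Lim (phi C) (D.lDeltaTheta l) (PiYdd C) ⊥) :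
    (autActOfCor218i C hq μ hC hS h15 L R hR h218i α.symm).symm x =
      autActOfCor218i C hq μ hC hS h15 L R hR h218i α x := by
  apply (autActOfCor218i C hq μ hC hS h15 L R hR h218i α.symm).injective
  rw [AddEquiv.apply_symm_apply, autActOfCor218i_symm, AddEquiv.symm_apply_apply]

/-- Equivariance with respect to conjugation (`Π^tp_Ÿ̲̲` normal: abc-iut-L6-t1's `piYdd_normal C hC`).
[cite: Mochizuki2012, Prop 3.4 (i) p.91] -/
theorem autActOfCor218i_conj [(PiYdd C).Normal] (hC : D.Compat) (hS : D.Sec2Hyps)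
    (h15 : D.Prop15iii E hC) (L : C.CuspLabels) (R : RigidData.{0} N l) (hR : R = C.rigidData μ hC hS h15 L)
    (h218i : R.Cor218_i) (α : (Pi C) ≃ₜ* (Pi C)) (h : Pi C)
    (x : h1Lim (phi C) (D.lDeltaTheta l) (PiYdd C) ⊥) :
    autActOfCor218i C hq μ hC hS h15 L R hR h218i α (h1LimConj (phi C) (D.lDeltaTheta l) (PiYdd C) h x) =
      h1LimConj (phi C) (D.lDeltaTheta l) (PiYdd C) (α h) (autActOfCor218i C hq μ hC hS h15 L R hR h218i α x) :=
  autAct_conj C hq α _ _ _ h x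

/-- **COMPARISON at F-0620**: an automorphism PAIR `(α, β)` of `(Π^tp_X̲̲, (Π^tp_X)^Θ)` (abc-iut-w5-d072's / abc-iut-w4-d030's
genuine inversion data) acts by `autActOfCor218i α` — the X-level companion is not needed to DEFINE the action, and
does not change it. [cite: Mochizuki2012, Cor 1.12 (i) p.57] -/
theorem pairRhoLim_eq_autActOfCor218i (hC : D.Compat) (hS : D.Sec2Hyps)
    (h15 : D.Prop15iii E hC) (L : C.CuspLabels) (R : RigidData.{0} N l) (hR : R = C.rigidData μ hC hS h15 L)
    (h218i : R.Cor218_i) (α : (Pi C) ≃ₜ* (Pi C)) (β : D.GtpTheta ≃ₜ* D.GtpTheta)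
    (hφ : ∀ g, β (phi C g) = phi C (α g)) (hAβ : ∀ a : D.GtpTheta, a ∈ D.lDeltaTheta l ↔ β a ∈ D.lDeltaTheta l)
    (hH : ∀ x, x ∈ PiYdd C ↔ α x ∈ PiYdd C) (x : h1Lim (phi C) (D.lDeltaTheta l) (PiYdd C) ⊥) :
    pairRhoLim C α β hφ hAβ hH x = autActOfCor218i C hq μ hC hS h15 L R hR h218i α x :=
  pairRhoLim_eq_autAct C hq α _ _ _ β hφ hAβ x

end FromCor218i

end EtaleThetaDataOfSetting

end Literature.IUT.HodgeArakelov

end
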